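import Summits.NavierStokesRegularity.NavierStokesRegularity.Theses.RellichScar
import Summits.NavierStokesRegularity.NavierStokesRegularity.Theorems.ScarRigidity.Negative.NeutralModeIdentity
import Literature.Analysis.FluidPDE.LeraySelfSimilarCalculus
import HarnessLib

/-!
# `ScarRigidity` (crux stmt-NavierStokesRegularity-11717, route RellichScar): an explicit ZERO-SCAR
# NEUTRAL MODE of the linearised Leray difference operator with a Type-I-critical potential —
# negative-side support (cdisprove seat, cycle 3)

The crux `Summit.NavierStokesRegularity.NavierStokesRegularity.Theses.RellichScar.ScarRigidity` says, in
Leray variables `y = x/√(−t)`, `s = −log(−t)`, that "an `s`-bounded `O(|y|⁻³)` solution of the linearised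
difference system (coefficients `U₁, ∇U₂ = O(|y|⁻¹), O(|y|⁻²)`, pressure) vanishes" (route file, item text).
This file shows, sorry-free, that the statement is FALSE at the level at which every size-based method
(Carleman / weighted / log-convexity estimates that use only the Type-I SIZE of the coefficients) operates:

* **The mode** (part 1, `NeutralModeProfile`; Plummer potential `G = ⟨y⟩⁻¹`, `⟨y⟩² = 1+|y|²`, unit vector `m`):
  `W(y) = ⟨y⟩⁻⁵[(2−|y|²) m + 3(m·y) y]` (`= ∇(∂ₘG) − (ΔG)m = curl(⟨y⟩⁻³ m×y)`; far field = the dipole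
  POTENTIAL flow `−∇(m·y/|y|³)`, zero scar; `W(0) = 2m`), pressure `Π(y) = ϖ(|y|²)(m·y)`,
  `ϖ(σ) = ⟨y⟩⁻⁹(−σ³ + 9σ²/2 + 159σ/2 − 31)`, and the RATIONAL matrix potential
  `M(y) = θ(|y|²) y⊗y`, `θ(σ) = (15/4)(4σ²+57σ−73)/(1+σ)⁴` (`|M| ~ 15/|y|²` at infinity,
  `sup (1+|y|²)‖M‖ ≈ 28.4`).
* **The identity** (part 2, `NeutralModeIdentity`) `neutral_identity`: `ΔW − ½(y·∇)W − ½W − M W − ∇Π = 0` on `ℝ³`, `div W = 0`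
  (`divergence_neutralW`), `‖W(y)‖² ≤ 4/(1+|y|²)³` (`norm_neutralW_sq_le`), `‖M(y)‖ ≤ 30/(1+|y|²)`
  (`norm_neutralM_le`).
* **Refuted statements** (each a `def … : Prop` immediately negated, as in the sibling file
  `LogicAndLoadBearing`): `NeutralModeRigidity 30` (stationary form), `LinearisedScarRigidity 30` (the
  eternal `s`-dependent form of the crux's linearised statement, with the drift dropped and `W·∇Ū`
  replaced by a general potential of the same critical size), and — in PHYSICAL variables on the whole
  open backward slab, through the tree's `lerayBackward` calculus — `DifferenceInequalityRigidity 30`: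
  `w(t,x) = (−t)^{-1/2} W(x/√(−t))` solves `∂ₜw − Δw + 𝓜 w + ∇π = 0`, `div w = 0`, with
  `‖𝓜(t,x)‖ ≤ 30/((−t)+|x|²)` (`≤ 60/(|x|+√−t)²`) and `|w|² ≤ 4(−t)²/((−t)+|x|²)³`, i.e. the apex
  Type-I bound `|w| ≤ 2√2/(|x|+√−t)`, cubic flatness `|w| ≤ 2(−t)/|x|³` (ZERO SCAR: `ess sup_{(−δ,0)×K}|w|
  ≤ 2δ/dist(K,0)³ → 0`), the finite-energy ticket `‖w(t)‖₂ = (−t)^{1/4}‖W‖₂`, and `w(t,0) = 2m/√(−t)`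
  (singular at the apex like a Type-I profile) — an eternal self-similar solution, `w ≠ 0`.

## Meaning for provers

1. A proof of `ScarRigidity` must use MORE about the background `ū = (u₁+u₂)/2` of the difference equation
   `∂ₜw − Δw + ū·∇w + w·∇ū + ∇π = 0` than the Type-I sizes `|ū| ≲ C/(|x|+√−t)`, `|∇ū| ≲ C/(|x|+√−t)²`
   (plus `div w = 0`, the apex bound, the zero scar with cubic flatness, finite energy, self-similarity):
   at potential size `30/((−t)+|x|²)` all of these coexist with `w ≠ 0`.  In particular the route's foreseen
   layer-2 split "DifferenceDecay (`O(|y|⁻³)`) → NonlinearAbsorption (weighted estimate absorbing `U·∇W`,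
   `W·∇U`, `RR(U⊗W)`)" is dead as a coefficient scheme, and FINITE-order versions of `FlatScarRigidity`
   (line moment-conditioned-rellich, step (B) with `∀ N` weakened to `N = 3`) are false at this level; the
   `∀ N` (all radiative moments) is necessary, not a convenience.
2. The non-rigidity is a PRESSURE effect.  For the scalar heat operator with a potential obeying the same
   bound `C/((−t)+|x|²)` — bounded off the apex — backward uniqueness from the scar HOLDS for every `C`
   (ESS exterior backward uniqueness, tree `ess_backward_uniqueness_holds`, then space-like unique
   continuation slice by slice).  Here the far field is carried by the zero-scar dipole potential flow
   (Serrin 1962; sibling witness `DipoleMomentFlowParabolicExterior`), regularised across the parabolic core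
   by the Plummer potential, the core defect `LW − ∇Π = −2ρ′(|y|²)(m·y)y` being absorbed EXACTLY by the
   critical potential because `y·W = 2(m·y)⟨y⟩⁻³` factors it.
3. NOT covered (open): a zero-scar neutral mode of the EXACT linearised operator `−Ū·∇W − W·∇Ū − ∇Π`
   around a divergence-free background `Ū` of Type-I size (`M` here is not a Jacobian `∇Ū`): an inverse
   transport problem along the closed streamlines of `W`.  Size-based log-convexity in `Ḣ⁻¹` (line
   finite-energy-log-convexity) is CONSISTENT with the mode: it forces `K_S‖M‖_{L³} ≥ √2`-type lower
   bounds on any such mode (here `≫ √2`), so thresholds below which rigidity holds are not contradicted.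

## References

* J. Serrin, Arch. Rational Mech. Anal. 9 (1962) 187–195 (potential flows). [Serrin1962]
* L. Escauriaza, G. Seregin, V. Šverák, Russ. Math. Surv. 58 (2003) 211–250 (backward uniqueness). [EscauriazaSereginSverak2003]
* Z. Lei, Z. Yang, C. Yuan, IMRN 2024 = arXiv:2311.02429 (non-trivial final data, bounded class). [LeiYangYuan2024]
* G. Koch, N. Nadirashvili, G. Seregin, V. Šverák, Acta Math. 203 (2009) (Type I, (1.6)). [KNSS2009]
-/


noncomputable section

open Set Filter Function MeasureTheory Metric TopologicalSpace InnerProductSpace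
open scoped Topology ENNReal NNReal RealInnerProductSpace Laplacian

set_option linter.dupNamespace false

namespace Summit.NavierStokesRegularity.NavierStokesRegularity.Theorems.ScarRigidity.Negative

open Literature.Analysis.FluidPDE

/-- Physical / similarity space. -/
local notation "ℝ³" => EuclideanSpace ℝ (Fin 3)

/-! ### §7.9 The refuted rigidity statements -/

/-- **ZERO-SCAR NEUTRAL-MODE RIGIDITY at potential size `C₂`** (similarity variables `y = x/√(−t)`):
every `C²` divergence-free STATIONARY solution `W` of the linearised Leray (Stokes–Ornstein–Uhlenbeck)
system `ΔW − ½(y·∇)W − ½W − M W − ∇Π = 0` on `ℝ³`, with a matrix potential of the Type-I-critical size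
`‖M(y)‖ ≤ C₂/(1+|y|²)` and the ZERO-SCAR decay `|W(y)|² ≤ K/(1+|y|²)³` (i.e. `w = O((−t)|x|⁻³)` in physical
variables), vanishes.  This is the coefficient/inequality form of the crux's linearised statement
("an s-bounded `O(|y|⁻³)` solution of the linearised difference system vanishes") with the drift dropped
and `W·∇Ū` (`|∇Ū| ≲ C⟨y⟩⁻²`) replaced by a general potential of the same size. -/
def NeutralModeRigidity (C₂ : ℝ) : Prop :=
  ∀ (W : ℝ³ → ℝ³) (P : ℝ³ → ℝ) (M : ℝ³ → ℝ³ →L[ℝ] ℝ³),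
    ContDiff ℝ 2 W → Differentiable ℝ P →
    (∀ y, ‖M y‖ ≤ C₂ / (1 + ‖y‖ ^ 2)) →
    (∀ y, VectorCalculus.divergence W y = 0) →
    (∃ K : ℝ, ∀ y, ‖W y‖ ^ 2 ≤ K / (1 + ‖y‖ ^ 2) ^ 3) →
    (∀ y, (Δ W) y - (1 / 2 : ℝ) • fderiv ℝ W y y - (1 / 2 : ℝ) • W y - M y (W y) - gradient P y = 0) →
    ∀ y, W y = 0

/-- The unit vector `e₀`. -/
def e0 : ℝ³ := EuclideanSpace.single 0 1

/-- `|e₀| = 1`. [folklore] -/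
theorem norm_e0 : ‖e0‖ = 1 := by simp [e0]

/-- `e₀ ≠ 0`. [folklore] -/
theorem e0_ne_zero : e0 ≠ 0 := by
  intro h; have := norm_e0; rw [h, norm_zero] at this; exact zero_ne_one this

/-- **NEUTRAL-MODE RIGIDITY IS FALSE at `C₂ = 30`**: the explicit mode `(W, Π, M)` of §7.3. -/
theorem neutralModeRigidity_false : ¬ NeutralModeRigidity 30 := by
  intro h
  have h0 := h (neutralW e0) (neutralP e0) neutralM (contDiff_neutralW e0)
    ((contDiff_neutralP e0 (n := 1)).differentiable one_ne_zero) norm_neutralM_le (divergence_neutralW e0)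
    ⟨4, norm_neutralW_sq_le e0 norm_e0⟩ (neutral_identity e0) 0
  rw [neutralW_zero] at h0
  exact e0_ne_zero (by simpa using h0)

/-- **THE ETERNAL (s-dependent) FORM, verbatim the shape of the crux's linearised statement**: every
two-sided (`s ∈ ℝ`) solution of `∂ₛW = ΔW − ½(y·∇)W − ½W − M W − ∇Π`, `div W = 0`, with potential size
`C₂` and the s-UNIFORM zero-scar bound `|W(s,y)|² ≤ K/(1+|y|²)³`, vanishes. -/
def LinearisedScarRigidity (C₂ : ℝ) : Prop :=
  ∀ (W : ℝ → ℝ³ → ℝ³) (P : ℝ → ℝ³ → ℝ) (M : ℝ → ℝ³ → ℝ³ →L[ℝ] ℝ³),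
    (∀ s, ContDiff ℝ 2 (W s)) → (∀ s, Differentiable ℝ (P s)) →
    (∀ s y, ‖M s y‖ ≤ C₂ / (1 + ‖y‖ ^ 2)) →
    (∀ s y, VectorCalculus.divergence (W s) y = 0) →
    (∃ K : ℝ, ∀ s y, ‖W s y‖ ^ 2 ≤ K / (1 + ‖y‖ ^ 2) ^ 3) →
    (∀ s y, timeDeriv W s y =
      (Δ (W s)) y - (1 / 2 : ℝ) • fderiv ℝ (W s) y y - (1 / 2 : ℝ) • W s y - M s y (W s y) - gradient (P s) y) →
    ∀ s y, W s y = 0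

/-- **LINEARISED SCAR RIGIDITY IS FALSE at `C₂ = 30`** (the stationary mode is an eternal solution). -/
theorem linearisedScarRigidity_false : ¬ LinearisedScarRigidity 30 := by
  intro h
  have h0 := h (fun _ => neutralW e0) (fun _ => neutralP e0) (fun _ => neutralM)
    (fun _ => contDiff_neutralW e0) (fun _ => (contDiff_neutralP e0 (n := 1)).differentiable one_ne_zero)
    (fun _ => norm_neutralM_le) (fun _ => divergence_neutralW e0) ⟨4, fun _ => norm_neutralW_sq_le e0 norm_e0⟩
    (fun s y => by rw [timeDeriv_apply, deriv_const, neutral_identity e0 y]) 0 0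
  rw [neutralW_zero] at h0
  exact e0_ne_zero (by simpa using h0)


/-! ### §7.10 Physical variables: `w = (−t)^{-1/2} W(x/√(−t))` on the backward slab -/

section Physical

variable (m : ℝ³)

/-- The Leray scale `λ(t) = 1/√(−t)` in the tree's normal form (`a = ½`, `T = 0`). -/
def sc (t : ℝ) : ℝ := (Real.sqrt (2 * (1 / 2 : ℝ) * (0 - t)))⁻¹

/-- `λ(t)² = (−t)⁻¹`. [folklore] -/
theorem sc_sq {t : ℝ} (ht : t < 0) : sc t ^ 2 = (-t)⁻¹ := by
  rw [sc, lerayScale_sq (by norm_num : (0 : ℝ) < 1 / 2) ht]; norm_num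

/-- `λ(t) > 0` for `t < 0`. [folklore] -/
theorem sc_pos {t : ℝ} (ht : t < 0) : 0 < sc t := lerayScale_pos (by norm_num : (0 : ℝ) < 1 / 2) ht

/-- `λ(−1) = 1`. [folklore] -/
theorem sc_neg_one : sc (-1) = 1 := by
  rw [sc, show (2 * (1 / 2 : ℝ) * (0 - (-1))) = 1 by norm_num, Real.sqrt_one, inv_one]

/-- THE PHYSICAL MODE `w(t,x) = λ W(λx)`, `λ = 1/√(−t)` (Leray's backward ansatz of the tree). -/
def physW : ℝ → ℝ³ → ℝ³ := lerayBackward (1 / 2) 0 (neutralW m)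

/-- Its pressure `π(t,x) = λ² Π(λx) = (−t)⁻¹ Π(x/√(−t))`. -/
def physP (t : ℝ) (x : ℝ³) : ℝ := sc t ^ 2 * neutralP m (sc t • x)

/-- Its potential `𝓜(t,x) = λ² M(λx) = (−t)⁻¹ M(x/√(−t))`. -/
def physM (t : ℝ) (x : ℝ³) : ℝ³ →L[ℝ] ℝ³ := sc t ^ 2 • neutralM (sc t • x)

/-- Unfolding `w(t,x) = λ W(λx)`. [folklore] -/
theorem physW_apply (t : ℝ) (x : ℝ³) : physW m t x = sc t • neutralW m (sc t • x) := rfl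

/-- **THE PDE in physical variables**: `∂ₜw − Δw + 𝓜 w + ∇π = 0` pointwise on `ℝ³ × (−∞,0)`. -/
theorem physW_momentum {t : ℝ} (ht : t < 0) (x : ℝ³) :
    timeDeriv (physW m) t x - (Δ (physW m t)) x + physM t x (physW m t x) + gradient (physP m t) x = 0 := by
  have ha : (0 : ℝ) < 1 / 2 := by norm_num
  have hT := timeDeriv_lerayBackward ha ht (contDiff_neutralW m (n := 1)) x
  have hL := laplacian_lerayBackward (contDiff_neutralW m (n := 2)) (1 / 2) 0 t x
  have hG : gradient (physP m t) x = sc t ^ 3 • gradient (neutralP m) (sc t • x) := by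
    have h : physP m t = fun y => sc t ^ 2 * (neutralP m (sc t • y) - 0) := by
      funext y; simp [physP]
    rw [h, gradient_sq_mul_comp_smul_sub]
  have hM : physM t x (physW m t x) = sc t ^ 3 • neutralM (sc t • x) (neutralW m (sc t • x)) := by
    rw [physW_apply, physM, smul_apply, map_smul, smul_smul, show sc t ^ 2 * sc t = sc t ^ 3 by ring]
  rw [hM, hG]
  unfold physW
  rw [hT, hL]
  have key := neutral_identity m (sc t • x)
  have e : ((1 / 2 : ℝ) * (Real.sqrt (2 * (1 / 2 : ℝ) * (0 - t)))⁻¹ ^ 3) •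
        (neutralW m ((Real.sqrt (2 * (1 / 2 : ℝ) * (0 - t)))⁻¹ • x) +
          fderiv ℝ (neutralW m) ((Real.sqrt (2 * (1 / 2 : ℝ) * (0 - t)))⁻¹ • x)
            ((Real.sqrt (2 * (1 / 2 : ℝ) * (0 - t)))⁻¹ • x)) -
        (Real.sqrt (2 * (1 / 2 : ℝ) * (0 - t)))⁻¹ ^ 3 •
          (Δ (neutralW m)) ((Real.sqrt (2 * (1 / 2 : ℝ) * (0 - t)))⁻¹ • x) +
        sc t ^ 3 • neutralM (sc t • x) (neutralW m (sc t • x)) +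
        sc t ^ 3 • gradient (neutralP m) (sc t • x) =
      -(sc t ^ 3) • ((Δ (neutralW m)) (sc t • x) - (1 / 2 : ℝ) • fderiv ℝ (neutralW m) (sc t • x) (sc t • x) -
        (1 / 2 : ℝ) • neutralW m (sc t • x) - neutralM (sc t • x) (neutralW m (sc t • x)) -
        gradient (neutralP m) (sc t • x)) := by
    simp only [sc]
    module
  rw [e, key, smul_zero]

/-- `div w(t) = 0`. -/
theorem physW_divFree (t : ℝ) (x : ℝ³) : VectorCalculus.divergence (physW m t) x = 0 := by
  rw [physW, divergence_lerayBackward, divergence_neutralW, mul_zero]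

/-- **APEX TYPE-I + CUBIC FLATNESS IN ONE BOUND**: `|w(t,x)|² ≤ 4(−t)²/((−t)+|x|²)³`, i.e.
`|w| ≤ 2/√((−t)+|x|²) ≤ 2√2/(|x|+√(−t))` (apex bound) and `|w| ≤ 2(−t)/|x|³` (zero scar). -/
theorem physW_sq_le (hm : ‖m‖ = 1) {t : ℝ} (ht : t < 0) (x : ℝ³) :
    ‖physW m t x‖ ^ 2 ≤ 4 * (-t) ^ 2 / (-t + ‖x‖ ^ 2) ^ 3 := by
  have hs2 := sc_sq ht
  obtain ⟨τ, hτ, rfl⟩ : ∃ τ : ℝ, 0 < τ ∧ t = -τ := ⟨-t, by linarith, by ring⟩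
  rw [neg_neg] at hs2 ⊢
  rw [physW_apply, norm_smul, mul_pow, Real.norm_eq_abs, sq_abs, hs2]
  have hW := norm_neutralW_sq_le m hm (sc (-τ) • x)
  rw [norm_smul, mul_pow, Real.norm_eq_abs, sq_abs, hs2] at hW
  have hx : 0 ≤ ‖x‖ ^ 2 := sq_nonneg _
  have e1 : 1 + τ⁻¹ * ‖x‖ ^ 2 = (τ + ‖x‖ ^ 2) / τ := by field_simp
  rw [e1, div_pow, div_div_eq_mul_div] at hW
  calc τ⁻¹ * ‖neutralW m (sc (-τ) • x)‖ ^ 2 ≤ τ⁻¹ * (4 * τ ^ 3 / (τ + ‖x‖ ^ 2) ^ 3) := by gcongr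
    _ = 4 * τ ^ 2 / (τ + ‖x‖ ^ 2) ^ 3 := by field_simp

/-- **CRITICAL SIZE OF THE POTENTIAL in physical variables**: `‖𝓜(t,x)‖ ≤ 30/((−t)+|x|²)`
(`≤ 60/(|x|+√(−t))²`). -/
theorem physM_le {t : ℝ} (ht : t < 0) (x : ℝ³) : ‖physM t x‖ ≤ 30 / (-t + ‖x‖ ^ 2) := by
  have hs2 := sc_sq ht
  obtain ⟨τ, hτ, rfl⟩ : ∃ τ : ℝ, 0 < τ ∧ t = -τ := ⟨-t, by linarith, by ring⟩
  rw [neg_neg] at hs2 ⊢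
  rw [physM, norm_smul, Real.norm_eq_abs, abs_of_nonneg (sq_nonneg _), hs2]
  have hM := norm_neutralM_le (sc (-τ) • x)
  rw [norm_smul, mul_pow, Real.norm_eq_abs, sq_abs, hs2] at hM
  have hx : 0 ≤ ‖x‖ ^ 2 := sq_nonneg _
  have e1 : 1 + τ⁻¹ * ‖x‖ ^ 2 = (τ + ‖x‖ ^ 2) / τ := by field_simp
  rw [e1, div_div_eq_mul_div] at hM
  calc τ⁻¹ * ‖neutralM (sc (-τ) • x)‖ ≤ τ⁻¹ * (30 * τ / (τ + ‖x‖ ^ 2)) := by gcongr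
    _ = 30 / (τ + ‖x‖ ^ 2) := by field_simp

/-- Non-triviality: `w(−1, 0) = 2m` (the mode is singular at the apex: `w(t,0) = 2m/√(−t)`). -/
theorem physW_neg_one_zero : physW m (-1) 0 = (2 : ℝ) • m := by
  rw [physW_apply, sc_neg_one, smul_zero, neutralW_zero, one_smul]

/-- Smoothness of the slices. -/
theorem contDiff_physW (t : ℝ) {n : ℕ∞} : ContDiff ℝ n (physW m t) := by
  have h : physW m t = fun x => sc t • neutralW m (sc t • x) := rfl
  rw [h]
  exact ((contDiff_neutralW m).comp (contDiff_const_smul _)).const_smul _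

/-- The pressure slices are smooth. [folklore] -/
theorem contDiff_physP (t : ℝ) {n : ℕ∞} : ContDiff ℝ n (physP m t) := by
  have h : physP m t = fun x => sc t ^ 2 * neutralP m (sc t • x) := rfl
  rw [h]
  exact contDiff_const.mul ((contDiff_neutralP m).comp (contDiff_const_smul _))

/-- The pressure slices are differentiable. [folklore] -/
theorem differentiable_physP (t : ℝ) : Differentiable ℝ (physP m t) :=
  (contDiff_physP m t (n := 1)).differentiable one_ne_zero

/-- **DIFFERENCE-INEQUALITY RIGIDITY at coefficient size `C₂`** (physical variables, the whole open
backward slab).  The difference `w = u₁ − u₂` of two scar-sharing apex profiles solves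
`∂ₜw − Δw + ū·∇w + w·∇ū + ∇π = 0`, `div w = 0`, with `|ū| ≤ C/(|x|+√−t)` and (by local regularity)
`|∇ū| ≲ C/(|x|+√−t)²`; a SIZE-BASED proof retains of `w·∇ū` only a potential `V` with
`‖V(t,x)‖ ≤ C₂/((−t)+|x|²)` (`≤ 2C₂/(|x|+√−t)²`).  The statement: every slice-wise `C²`, divergence-free
`w` on `ℝ³×(−∞,0)` solving `∂ₜw − Δw + V w + ∇p = 0` with such a `V`, and obeying the single bound
`|w(t,x)|² ≤ K(−t)²/((−t)+|x|²)³` — which packs the APEX TYPE-I bound `|w| ≤ √(2K)/(|x|+√−t)`, the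
ZERO SCAR with cubic flatness `|w| ≤ √K(−t)/|x|³` (so `ess sup_{(−δ,0)×K}|w| → 0`) and the finite-energy
ticket `‖w(t)‖₂ ≲ (−t)^{1/4}` — vanishes identically. -/
def DifferenceInequalityRigidity (C₂ : ℝ) : Prop :=
  ∀ (w : ℝ → ℝ³ → ℝ³) (p : ℝ → ℝ³ → ℝ) (V : ℝ → ℝ³ → ℝ³ →L[ℝ] ℝ³),
    (∀ t < 0, ContDiff ℝ 2 (w t)) → (∀ t < 0, Differentiable ℝ (p t)) →
    (∀ t < 0, ∀ x, ‖V t x‖ ≤ C₂ / (-t + ‖x‖ ^ 2)) →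
    (∀ t < 0, ∀ x, VectorCalculus.divergence (w t) x = 0) →
    (∃ K : ℝ, ∀ t < 0, ∀ x, ‖w t x‖ ^ 2 ≤ K * (-t) ^ 2 / (-t + ‖x‖ ^ 2) ^ 3) →
    (∀ t < 0, ∀ x, timeDeriv w t x - (Δ (w t)) x + V t x (w t x) + gradient (p t) x = 0) →
    ∀ t < 0, ∀ x, w t x = 0

/-- **DIFFERENCE-INEQUALITY RIGIDITY IS FALSE at `C₂ = 30`**: the self-similar mode
`w = (−t)^{-1/2} W(x/√(−t))` with its pressure and potential (an ETERNAL solution on the whole slab,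
singular at the apex like a Type-I profile: `w(t,0) = 2e₀/√(−t)`). -/
theorem differenceInequalityRigidity_false : ¬ DifferenceInequalityRigidity 30 := by
  intro h
  have h0 := h (physW e0) (physP e0) physM (fun t _ => contDiff_physW e0 t) (fun t _ => differentiable_physP e0 t)
    (fun t ht x => physM_le ht x) (fun t _ x => physW_divFree e0 t x)
    ⟨4, fun t ht x => by simpa using physW_sq_le e0 norm_e0 ht x⟩ (fun t ht x => physW_momentum e0 ht x)
    (-1) (by norm_num) 0
  rw [physW_neg_one_zero] at h0
  exact e0_ne_zero (by simpa using h0)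

end Physical

end Summit.NavierStokesRegularity.NavierStokesRegularity.Theorems.ScarRigidity.Negative

end
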